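import Summits.CriticalPhenomena.PercolationContinuityZ3.Theorems.PercNearOneGluingNoHeavyLowerTailSahiE3ExchangeCross
import Mathlib.Tactic.Linarith
import Mathlib.Tactic.Ring
import Mathlib.Tactic.Positivity
import HarnessLib
import HarnessLib.Audit

/-!
# `NoHeavyLowerTail` (crux stmt-CriticalPhenomena-4575), Sahi programme P4: the 2×2 exchange lemma — reduction to an `R`-free inequality by admissible sub-pairs

Support file (cell `prim-l12`, seat P4, generation 21; `--supports stmt-CriticalPhenomena-4575`).  No named facts, no sorries;
standard axioms; def-free.

Context (HOME prim-l12-p4/FROM-prim-l12-p4-gen21-SATURATED-EXCHANGE.md).  In the 2×2 exchange lemma (see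
`…SahiE3ExchangeCross`, `…SahiE3ExchangeEmptyLayer`) the certificate `R` enters only through the supplies `R(KK'V) + R(LL'V)`.
Gen 21 showed (exact LP) that the minimum of this supply over the whole pair polytope `P_L(V)` is always attained by an integral
two-set packing, and that the two footprints `F₁ = K∩L'∩(L∪K')∩V`, `F₂ = L∩K'∩(K∪L')∩V` (the cross footprints with the crossing
cells removed) always suffice.  This file makes the corresponding reduction formal and `R`-free:
* `two_footprints_le_supply`: if `X₁∩Y₁ ⊆ K∩L'∩(L∪K')` and `X₂∩Y₂ ⊆ L∩K'∩(K∪L')` then, pointwise on `V`,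
  `1_{X₁Y₁} + 1_{X₂Y₂} ≤ 1_{KK'} + 1_{LL'}`, hence `R(X₁Y₁V) + R(X₂Y₂V) ≤ R(KK'V) + R(LL'V)` for `R ≥ 0` on `V`;
* `exchange_of_subpairs`: for ANY bracket value `Y` and ANY such admissible sub-pairs, the two pair inequalities at
  `(X₁,Y₁)`, `(X₂,Y₂)` plus the `R`-FREE residual inequality
  `need(K,L') + need(L,K') − need(X₁,Y₁) − need(X₂,Y₂) ≤ X_a + (1−v)·Y` imply the exchange expression `≥ 0`.
So the exchange lemma for all `R ∈ P_L(V)` is reduced, in the tree, to choosing admissible pairs and proving an inequality about the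
Harris block alone (the empty-layer classes of `…SahiE3ExchangeEmptyLayer` are the instances `(K, K'∩L')`, `(L, K'∩L')`; the
general candidates are the Heyting-saturated pairs of the HOME memo, §0 F3/F5).
-/

namespace Summit.CriticalPhenomena.PercolationContinuityZ3.Theorems.SahiE3ExchangeSubpairs

open Finset SahiE3DimerPacking SahiE3ExchangeCross
open scoped BigOperators

variable {B : Type*} [DecidableEq B]

/-- **Two admissible footprints fit under the supply.**  If `R ≥ 0` on `V`, `X₁ ∩ Y₁ ⊆ K ∩ L' ∩ (L ∪ K')` and
`X₂ ∩ Y₂ ⊆ L ∩ K' ∩ (K ∪ L')`, then `R(X₁∩Y₁∩V) + R(X₂∩Y₂∩V) ≤ R(K∩K'∩V) + R(L∩L'∩V)`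
(pointwise: a point of the first footprint lies in `K∩L'` and in `L` or `K'`, hence in `LL'` or `KK'`; a point of both lies in
`K∩K'∩L∩L'`). [this work] -/
theorem two_footprints_le_supply (R : B → ℝ) (V K L K' L' X₁ Y₁ X₂ Y₂ : Finset B) (hR : ∀ b ∈ V, 0 ≤ R b)
    (h₁ : X₁ ∩ Y₁ ⊆ K ∩ L' ∩ (L ∪ K')) (h₂ : X₂ ∩ Y₂ ⊆ L ∩ K' ∩ (K ∪ L')) :
    ∑ b ∈ (X₁ ∩ Y₁) ∩ V, R b + ∑ b ∈ (X₂ ∩ Y₂) ∩ V, R b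
      ≤ ∑ b ∈ (K ∩ K') ∩ V, R b + ∑ b ∈ (L ∩ L') ∩ V, R b := by
  simp only [sum_inter_eq_sum_ite, ← Finset.sum_add_distrib]
  refine Finset.sum_le_sum fun b hb => ?_
  have hRb := hR b hb
  by_cases hf₁ : b ∈ X₁ ∩ Y₁ <;> by_cases hf₂ : b ∈ X₂ ∩ Y₂
  · -- both footprints: b ∈ K ∩ K' and b ∈ L ∩ L'
    have g₁ := h₁ hf₁; have g₂ := h₂ hf₂
    simp only [Finset.mem_inter, Finset.mem_union] at g₁ g₂
    have hkk : b ∈ K ∩ K' := Finset.mem_inter.2 ⟨g₁.1.1, g₂.1.2⟩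
    have hll : b ∈ L ∩ L' := Finset.mem_inter.2 ⟨g₂.1.1, g₁.1.2⟩
    simp only [hf₁, hf₂, hkk, hll, ↓reduceIte]; linarith
  · have g₁ := h₁ hf₁
    simp only [Finset.mem_inter, Finset.mem_union] at g₁
    rcases g₁.2 with hl | hk'
    · have hll : b ∈ L ∩ L' := Finset.mem_inter.2 ⟨hl, g₁.1.2⟩
      simp only [hf₁, hf₂, hll, ↓reduceIte, add_zero]
      by_cases hkk : b ∈ K ∩ K' <;> simp only [hkk, ↓reduceIte] <;> linarith
    · have hkk : b ∈ K ∩ K' := Finset.mem_inter.2 ⟨g₁.1.1, hk'⟩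
      simp only [hf₁, hf₂, hkk, ↓reduceIte, add_zero]
      by_cases hll : b ∈ L ∩ L' <;> simp only [hll, ↓reduceIte] <;> linarith
  · have g₂ := h₂ hf₂
    simp only [Finset.mem_inter, Finset.mem_union] at g₂
    rcases g₂.2 with hk | hl'
    · have hkk : b ∈ K ∩ K' := Finset.mem_inter.2 ⟨hk, g₂.1.2⟩
      simp only [hf₁, hf₂, hkk, ↓reduceIte, zero_add]
      by_cases hll : b ∈ L ∩ L' <;> simp only [hll, ↓reduceIte] <;> linarith
    · have hll : b ∈ L ∩ L' := Finset.mem_inter.2 ⟨g₂.1.1, hl'⟩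
      simp only [hf₁, hf₂, hll, ↓reduceIte, zero_add]
      by_cases hkk : b ∈ K ∩ K' <;> simp only [hkk, ↓reduceIte] <;> linarith
  · simp only [hf₁, hf₂, ↓reduceIte, add_zero]
    by_cases hkk : b ∈ K ∩ K' <;> by_cases hll : b ∈ L ∩ L' <;> simp only [hkk, hll, ↓reduceIte] <;> linarith

/-- **Reduction of the exchange lemma to an `R`-free residual inequality.**  For a weight `w`, the slot `V` (`v = w(V)`),
`R ≥ 0` on `V`, configuration sets `P, K, L, O, P', K', L', O'`, ANY bracket value `Y : ℝ`, and admissible sub-pairs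
`X₁∩Y₁ ⊆ K∩L'∩(L∪K')`, `X₂∩Y₂ ⊆ L∩K'∩(K∪L')`: if `R` satisfies the pair inequality at `(X₁,Y₁)` and `(X₂,Y₂)` and the residual
`need(K,L') + need(L,K') − need(X₁,Y₁) − need(X₂,Y₂) ≤ X_a + (1−v)·Y` holds (`X_a = w(PP'V)+w(OO'V)−w(P)w(O'V)−w(P')w(OV)`), then
`X_a + R(KK'V) + R(LL'V) − need(K,L') − need(L,K') + (1−v)·Y ≥ 0` — the exchange expression of `…SahiE3ExchangeCross` with
bracket `Y` (type 2: `Y = Har(P,P') + (p−k)(p'−l') + (p−l)(p'−k')`; type 1: `Y = Har(P,P') + (p−k)(k'−o') + (p−o)(p'−k')`).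
[this work] -/
theorem exchange_of_subpairs (w R : B → ℝ) (V K L P O K' L' P' O' X₁ Y₁ X₂ Y₂ : Finset B) (Y : ℝ)
    (hR : ∀ b ∈ V, 0 ≤ R b)
    (h₁ : X₁ ∩ Y₁ ⊆ K ∩ L' ∩ (L ∪ K')) (h₂ : X₂ ∩ Y₂ ⊆ L ∩ K' ∩ (K ∪ L'))
    (hpair₁ : (∑ b ∈ X₁, w b) * (∑ b ∈ Y₁ ∩ V, w b) + (∑ b ∈ Y₁, w b) * (∑ b ∈ X₁ ∩ V, w b)
        - (∑ b ∈ V, w b) * (∑ b ∈ X₁, w b) * (∑ b ∈ Y₁, w b) ≤ ∑ b ∈ (X₁ ∩ Y₁) ∩ V, R b)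
    (hpair₂ : (∑ b ∈ X₂, w b) * (∑ b ∈ Y₂ ∩ V, w b) + (∑ b ∈ Y₂, w b) * (∑ b ∈ X₂ ∩ V, w b)
        - (∑ b ∈ V, w b) * (∑ b ∈ X₂, w b) * (∑ b ∈ Y₂, w b) ≤ ∑ b ∈ (X₂ ∩ Y₂) ∩ V, R b)
    (hres : ((∑ b ∈ K, w b) * (∑ b ∈ L' ∩ V, w b) + (∑ b ∈ L', w b) * (∑ b ∈ K ∩ V, w b)
              - (∑ b ∈ V, w b) * (∑ b ∈ K, w b) * (∑ b ∈ L', w b))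
          + ((∑ b ∈ L, w b) * (∑ b ∈ K' ∩ V, w b) + (∑ b ∈ K', w b) * (∑ b ∈ L ∩ V, w b)
              - (∑ b ∈ V, w b) * (∑ b ∈ L, w b) * (∑ b ∈ K', w b))
          - ((∑ b ∈ X₁, w b) * (∑ b ∈ Y₁ ∩ V, w b) + (∑ b ∈ Y₁, w b) * (∑ b ∈ X₁ ∩ V, w b)
              - (∑ b ∈ V, w b) * (∑ b ∈ X₁, w b) * (∑ b ∈ Y₁, w b))
          - ((∑ b ∈ X₂, w b) * (∑ b ∈ Y₂ ∩ V, w b) + (∑ b ∈ Y₂, w b) * (∑ b ∈ X₂ ∩ V, w b)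
              - (∑ b ∈ V, w b) * (∑ b ∈ X₂, w b) * (∑ b ∈ Y₂, w b))
        ≤ (∑ b ∈ (P ∩ P') ∩ V, w b) + (∑ b ∈ (O ∩ O') ∩ V, w b)
            - (∑ b ∈ P, w b) * (∑ b ∈ O' ∩ V, w b) - (∑ b ∈ P', w b) * (∑ b ∈ O ∩ V, w b)
          + (1 - ∑ b ∈ V, w b) * Y) :
    0 ≤ (∑ b ∈ (P ∩ P') ∩ V, w b) + (∑ b ∈ (O ∩ O') ∩ V, w b)
        - (∑ b ∈ P, w b) * (∑ b ∈ O' ∩ V, w b) - (∑ b ∈ P', w b) * (∑ b ∈ O ∩ V, w b)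
        + (∑ b ∈ (K ∩ K') ∩ V, R b) + (∑ b ∈ (L ∩ L') ∩ V, R b)
        - ((∑ b ∈ K, w b) * (∑ b ∈ L' ∩ V, w b) + (∑ b ∈ L', w b) * (∑ b ∈ K ∩ V, w b)
            - (∑ b ∈ V, w b) * (∑ b ∈ K, w b) * (∑ b ∈ L', w b))
        - ((∑ b ∈ L, w b) * (∑ b ∈ K' ∩ V, w b) + (∑ b ∈ K', w b) * (∑ b ∈ L ∩ V, w b)
            - (∑ b ∈ V, w b) * (∑ b ∈ L, w b) * (∑ b ∈ K', w b))
        + (1 - ∑ b ∈ V, w b) * Y := by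
  have hsup := two_footprints_le_supply R V K L K' L' X₁ Y₁ X₂ Y₂ hR h₁ h₂
  linarith

/-- **Admissibility of the four raw cut pairs.**  The raw B-cut and A-cut pairs of the HOME memo, `(K, L'∩(L∪K'))` and
`(K∩(L∪K'), L')` for pair 1, `(L, K'∩(K∪L'))` and `(L∩(K∪L'), K')` for pair 2, have admissible footprints for
`exchange_of_subpairs` (pure `Finset` inclusions, recorded for convenience). [this work] -/
theorem rawpair_admissible (K L K' L' : Finset B) :
    K ∩ (L' ∩ (L ∪ K')) ⊆ K ∩ L' ∩ (L ∪ K') ∧ (K ∩ (L ∪ K')) ∩ L' ⊆ K ∩ L' ∩ (L ∪ K') ∧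
    L ∩ (K' ∩ (K ∪ L')) ⊆ L ∩ K' ∩ (K ∪ L') ∧ (L ∩ (K ∪ L')) ∩ K' ⊆ L ∩ K' ∩ (K ∪ L') := by
  refine ⟨?_, ?_, ?_, ?_⟩ <;> intro b hb <;> simp only [Finset.mem_inter, Finset.mem_union] at hb ⊢ <;> tauto

/-- **Admissibility of Heyting-saturated partners.**  If every point of `Yp` "above which `X∩V` stays inside `F`" in the weak
sense `b ∈ Yp → b ∈ X → b ∈ V → b ∈ F` (the reflexive instance of the arrow `X ⇒ F = {b : ↑b ∩ X ∩ V ⊆ F}`), and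
`F ⊆ K ∩ L' ∩ (L ∪ K')`, then the pair `(X, Yp)` has an admissible footprint ON `V`: `X ∩ Yp ∩ V ⊆ K ∩ L' ∩ (L ∪ K')`.  (To use
`exchange_of_subpairs`, whose hypothesis is stated without `V`, intersect the partner with an up-set whose `V`-trace is `F`, or
apply this lemma's conclusion through `two_footprints_le_supply` restated on `V`; recorded here as the footprint fact behind the
saturated candidates πK, πP, πF, πG of the memo.) [this work] -/
theorem saturated_footprint (V X Yp F K L K' L' : Finset B)
    (hY : ∀ b ∈ Yp, b ∈ X → b ∈ V → b ∈ F) (hF : F ⊆ K ∩ L' ∩ (L ∪ K')) :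
    (X ∩ Yp) ∩ V ⊆ K ∩ L' ∩ (L ∪ K') := by
  intro b hb
  simp only [Finset.mem_inter] at hb
  exact hF (hY b hb.1.2 hb.1.1 hb.2)

end Summit.CriticalPhenomena.PercolationContinuityZ3.Theorems.SahiE3ExchangeSubpairs
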